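import Summits.HodgeConjecture.HodgeConjecture.Theorems.F0P2aArchOrthCore
import Summits.HodgeConjecture.HodgeConjecture.Theorems.F0P2aL2eExpGeneration
import Summits.HodgeConjecture.HodgeConjecture.Theorems.F0P2aL2aKSchur
import Summits.HodgeConjecture.HodgeConjecture.Theorems.F0P2aL2bHolArchSmooth
import Summits.HodgeConjecture.HodgeConjecture.Theorems.F0P2aL2bSliceContinuous
import Summits.HodgeConjecture.HodgeConjecture.Theorems.F0P2aL2cOrderedProducts
import Summits.HodgeConjecture.HodgeConjecture.Theorems.F0P2aStubL2dNelson
import Summits.HodgeConjecture.HodgeConjecture.Theorems.F0P2aCmFrameFactorisation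
import Summits.HodgeConjecture.HodgeConjecture.Theorems.H413SpectrumJunction
import Literature.NumberTheory.Automorphic.AutomorphicAnalyticVectorsGeneral
import Literature.NumberTheory.Automorphic.AdelicUnitaryGroupDatum
import Literature.AlgebraicGeometry.ShimuraVarieties.UnitaryBallCartanDecomposition
import HarnessLib

/-!
# F0-P2a · S2⁺ `stub_archOrth_hol : ArchOrthHolType` FROM ITS CUTS — II: the CM composition (lead p01)

Cell hodgecm-mathlib, FLOOR 0; crux `H413` = `stmt-HodgeConjecture-24833`, route `HCCMUnconditional`; line
`Cruxes/H413/Lines/F0_P2aCohIsotypicLine.lean` (fe64be0a), stub S2⁺ `stub_archOrth_hol` (L, HARDEST).  THEOREMS ONLY;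
`--supports stmt-HodgeConjecture-24833 --as helper`.  HC_CM is proved only modulo the printed citations until rung 0 closes.

`archOrthHol_of_cuts hA hBi hBii hC hD hE : ⟨ArchOrthHolType body, token for token⟩` assembles the archimedean core of the
isotypic-line letter from the registered sub-lemma TYPES of the CUT (`F0/P2a/F0P2a-p01/CUT-S2plus.v1.md`, signatures v3):

* `hA`  (L2A, K∞-Schur, p04): trace-orthogonal holomorphic pair ⇒ all coordinate classes orthogonal;
* `hBi` (L2B-i, p03): coordinates of holomorphic cotangent forms are smooth in the archimedean variable along `cmArchSection`;
* `hBii` (L2B-ii, p03): slice-continuous + `K_c`-invariant + `K_f`-invariant functions on `U(H)(𝔸)` are continuous;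
* `hC`  (L2C, A-p08/p08): ordered products + `z₀`-weights: the `𝔤`-span of a `𝔨`-stable `𝔭⁻`-null `h₀`-eigen `V` inside an
  `L²`-Lie-stable space of smooth functions is orthogonal to any `h₀`-eigenvector (same eigenvalue) orthogonal to `V`;
* `hD`  (L2D, p02): Nelson–Harish-Chandra analyticity of the matrix coefficients of every element of the `𝔤`-span of a finite-dimensional
  `𝔨`-stable `𝔭⁻`-null `V` (= ★/pending `U21AnalyticVectors.analyticAt_inner_rightRegular_toLp_of_u21_null_of_mem_lieSpan`);
* `hE`  (L2E-i, p01): a subgroup of `U(2,1)` containing `exp 𝔲(2,1)` is everything;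

and — in `stub_archOrth_hol_holds` — FOLDS the ★ closers BY NAME: `hA := F0P2aL2aKSchur.l2a_holds` (p04), `hBi := F0P2aL2bHolArchSmooth.sig_L2Bi_holds`,
`hBii := F0P2aL2bSliceContinuous.sig_L2Bii_holds` (p03), `hD := F0P2aStubL2dNelson.stub_L2d_holds` = ★ `U21AnalyticVectors.analyticAt_inner_rightRegular_toLp_of_u21_null_of_mem_lieSpan`
(p02), `hE := F0P2aL2eExpGeneration.subgroup_eq_top_of_forall_expMem_mem` (p01), `hC := F0P2aL2cOrderedProducts.sig_L2C_holds` (A-p08/p08) — so `stub_archOrth_hol_holds` PROVES S2⁺ = `ArchOrthHolType` OUTRIGHT.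
The core (★ `F0P2aArchOrthCore`) PROVES the rest: the V₀-facts (★ `F0P2aArchOrthPrelim`: CR from holomorphic germs, infinitesimal `K`-type, `h₀ = iJ ↦ 2i`), the
`W`-package (the space of archimedean-smooth, left-`U(H)(L⁺)`-invariant, right-`K_c`- and `K_f`-invariant functions is Lie-stable, consists of
continuous functions — compact quotient ★ `compactSpace_cmDatum_automorphicQuotient_of_posDef` — hence is `L²`-representable with injective
class map), Harish-Chandra's closure theorem ★ `closure_l2OfForms_exp_invariant_of_analytic_of_memLp` for the archimedean-only automorphy
datum `(u21Group, cmArchSection, ⊥, {⊥}, 0)`, and the passage `exp 𝔲(2,1) ↝ U(2,1)` through the stabiliser subgroup of the closed span.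

## References
* [HarishChandraTAMS1953] Harish-Chandra, Trans. AMS 75 (1953), Cor. to Thm 2 (pp. 210–211), Lemma 34.
* [Nelson1959] E. Nelson, Ann. Math. 70 (1959), §8.  [BorelWallach2000] VII 2.10, 3.2.  [Liu2021] arXiv:2106.08732 Lem. D.2 (2).
* [BorelJacquet1979] Corvallis §4.1–4.6.  [Knapp2002] I.§10, VI.§2.
-/

set_option autoImplicit false
set_option linter.dupNamespace false

noncomputable section

open scoped Matrix MatrixGroups Topology InnerProductSpace ENNReal ComplexConjugate ComplexOrder
open MeasureTheory NumberField Filter MulAction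
open Literature.NumberTheory.Automorphic Literature.NumberTheory.Automorphic.UnitaryGroup
open Literature.NumberTheory.Automorphic.UnitaryGroup.CotangentForms (toQuotFun toQuotFun_mk cmArchSection cmCompactFactor holCotForms
  mem_holCotForms_iff)
open Literature.Geometry.ComplexHyperbolic Literature.Geometry.ComplexHyperbolic.BallModel
open Literature.AlgebraicGeometry.ShimuraVarieties Literature.AlgebraicGeometry.ShimuraVarieties.BallForms
open Summit.HodgeConjecture.HodgeConjecture.Cruxes.H413.SpectrumJunction
open Summit.HodgeConjecture.HodgeConjecture.Cruxes.H413.F0P2aArchOrthPrelim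
open Summit.HodgeConjecture.HodgeConjecture.Cruxes.H413.F0P2aCmFrameFactorisation

namespace Summit.HodgeConjecture.HodgeConjecture.Cruxes.H413.F0P2aArchOrthHol

/-! ## §3 The CM frame `(L, ι, H, T, hT)`: the `W`-package and the composition `archOrthHol_of_cuts` -/

section CM

/-- **S2⁺ FROM ITS CUTS.**  `ArchOrthHolType` (line `F0_P2aCohIsotypicLine`, :134–146, abbreviations `𝒰`, `hol` unfolded) from
L2A (`hA`), L2B-i (`hBi`), L2B-ii (`hBii`), L2C (`hC`), L2D (`hD`) and L2E-i (`hE`).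
[cite: HarishChandraTAMS1953, Cor. to Thm 2; Lemma 34] [cite: BorelWallach2000, VII 3.2] [cite: Liu2021, Lem. D.2 (2)] -/
theorem archOrthHol_of_cuts
    (hA : ∀ (L : Type) [Field L] [NumberField L] [IsCMField L] (ι : L →+* ℂ) (H : Matrix (Fin 3) (Fin 3) L) (T : GL (Fin 3) ℂ)
      (hT : (T : Matrix (Fin 3) (Fin 3) ℂ)ᴴ * H.map ι * (T : Matrix (Fin 3) (Fin 3) ℂ) = Literature.Geometry.ComplexHyperbolic.BallModel.J)
      (μ : Measure (adelicGroupData (↥(maximalRealSubfield L)) L (IsCMField.complexConj L) 3 H).automorphicQuotient)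
      [(adelicGroupData (↥(maximalRealSubfield L)) L (IsCMField.complexConj L) 3 H).IsAutomorphicMeasure μ]
      (Φ Φ₃ : (adelicGroupData (↥(maximalRealSubfield L)) L (IsCMField.complexConj L) 3 H).Adelic → (Fin 2 → ℂ)),
      Φ ∈ holCotForms (↥(maximalRealSubfield L)) L (IsCMField.complexConj L) 3 H (cmArchSection L ι H T hT) (cmCompactFactor L ι H T hT) →
      Φ₃ ∈ holCotForms (↥(maximalRealSubfield L)) L (IsCMField.complexConj L) 3 H (cmArchSection L ι H T hT) (cmCompactFactor L ι H T hT) →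
      ∀ (hΦ : ∀ j : Fin 2, MemLp (toQuotFun (adelicGroupData (↥(maximalRealSubfield L)) L (IsCMField.complexConj L) 3 H) fun x => Φ x j) 2 μ)
        (h₃ : ∀ j : Fin 2, MemLp (toQuotFun (adelicGroupData (↥(maximalRealSubfield L)) L (IsCMField.complexConj L) 3 H) fun x => Φ₃ x j) 2 μ),
      ∑ j : Fin 2, ⟪(hΦ j).toLp (toQuotFun _ fun x => Φ x j), (h₃ j).toLp (toQuotFun _ fun x => Φ₃ x j)⟫_ℂ = 0 →
      ∀ j j' : Fin 2, ⟪(hΦ j).toLp (toQuotFun _ fun x => Φ x j), (h₃ j').toLp (toQuotFun _ fun x => Φ₃ x j')⟫_ℂ = 0)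
    (hBi : ∀ (L : Type) [Field L] [NumberField L] [IsCMField L] (ι : L →+* ℂ) (H : Matrix (Fin 3) (Fin 3) L) (T : GL (Fin 3) ℂ)
      (hT : (T : Matrix (Fin 3) (Fin 3) ℂ)ᴴ * H.map ι * (T : Matrix (Fin 3) (Fin 3) ℂ) = Literature.Geometry.ComplexHyperbolic.BallModel.J),
      ∀ Φ ∈ holCotForms (↥(maximalRealSubfield L)) L (IsCMField.complexConj L) 3 H (cmArchSection L ι H T hT) (cmCompactFactor L ι H T hT),
      ∀ j : Fin 2, IsArchSmooth (H := u21Group) (cmArchSection L ι H T hT) (fun x => Φ x j))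
    (hBii : ∀ (L : Type) [Field L] [NumberField L] [IsCMField L] (ι : L →+* ℂ) (H : Matrix (Fin 3) (Fin 3) L) (T : GL (Fin 3) ℂ)
      (hT : (T : Matrix (Fin 3) (Fin 3) ℂ)ᴴ * H.map ι * (T : Matrix (Fin 3) (Fin 3) ℂ) = Literature.Geometry.ComplexHyperbolic.BallModel.J),
      (∀ τ' : L →+* ℂ, InfinitePlace.mk τ' ≠ InfinitePlace.mk ι → (H.map τ').PosDef) →
      ∀ ψ : (adelicGroupData (↥(maximalRealSubfield L)) L (IsCMField.complexConj L) 3 H).Adelic → ℂ,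
      (∀ x, Continuous fun u : ↥U21 => ψ (x * cmArchSection L ι H T hT u)) →
      (∀ k ∈ cmCompactFactor L ι H T hT, ∀ x, ψ (x * k) = ψ x) →
      (∃ Kf : Subgroup (finAdelic (↥(maximalRealSubfield L)) L (IsCMField.complexConj L) 3 H),
        IsOpen (Kf : Set (finAdelic (↥(maximalRealSubfield L)) L (IsCMField.complexConj L) 3 H)) ∧
        ∀ k ∈ Kf, ∀ x, ψ (x * finAdelicToAdelic (↥(maximalRealSubfield L)) L (IsCMField.complexConj L) 3 H k) = ψ x) →
      Continuous ψ)
    (hC : ∀ {K : Type} [Field K] [NumberField K] (𝒢 : AdelicGroupData.{0} K) (ι : ↥U21 →* 𝒢.Adelic), Continuous ι →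
      ∀ (μ : Measure 𝒢.automorphicQuotient) [𝒢.IsAutomorphicMeasure μ] (W : Submodule ℂ (𝒢.Adelic → ℂ)),
      (∀ φ ∈ W, IsArchSmooth (H := u21Group) ι φ) →
      (∀ (X : u21Group.lie), ∀ φ ∈ W, lieDeriv (H := u21Group) ι X φ ∈ W) →
      W ≤ 𝒢.l2Representable μ →
      ∀ (h₀ : u21Group.lie), (h₀ : Matrix (Fin 3) (Fin 3) ℂ) = Complex.I • Literature.Geometry.ComplexHyperbolic.BallModel.J →
      ∀ (c : ℂ) (V : Submodule ℂ (𝒢.Adelic → ℂ)), V ≤ W → FiniteDimensional ℂ V →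
      (∀ Y : u21Group.lie, (Y : Matrix (Fin 3) (Fin 3) ℂ) * Literature.Geometry.ComplexHyperbolic.BallModel.J =
          Literature.Geometry.ComplexHyperbolic.BallModel.J * (Y : Matrix (Fin 3) (Fin 3) ℂ) →
        ∀ φ ∈ V, lieDeriv (H := u21Group) ι Y φ ∈ V) →
      (∀ (b : Fin 2 → ℂ), ∀ φ ∈ V, lieDeriv (H := u21Group) ι (liePMat (Complex.I • b)) φ =
        Complex.I • lieDeriv (H := u21Group) ι (liePMat b) φ) →
      (∀ φ ∈ V, lieDeriv (H := u21Group) ι h₀ φ = c • φ) →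
      ∀ ψ₃ ∈ W, lieDeriv (H := u21Group) ι h₀ ψ₃ = c • ψ₃ →
      ∀ (f₃ : 𝒢.automorphicQuotient → ℂ) (hf₃ : MemLp f₃ 2 μ), invQuot 𝒢 f₃ = ψ₃ →
      (∀ φ ∈ V, ∀ (f : 𝒢.automorphicQuotient → ℂ) (hf : MemLp f 2 μ), invQuot 𝒢 f = φ → ⟪hf.toLp f, hf₃.toLp f₃⟫_ℂ = 0) →
      ∃ S : Submodule ℂ (𝒢.Adelic → ℂ), V ≤ S ∧ S ≤ W ∧
        (∀ (X : u21Group.lie), ∀ φ ∈ S, lieDeriv (H := u21Group) ι X φ ∈ S) ∧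
        (∀ φ ∈ S, ∀ (f : 𝒢.automorphicQuotient → ℂ) (hf : MemLp f 2 μ), invQuot 𝒢 f = φ → ⟪hf.toLp f, hf₃.toLp f₃⟫_ℂ = 0))
    (hD : ∀ {K : Type} [Field K] [NumberField K] {𝒢 : AdelicGroupData.{0} K}
      {μ : Measure 𝒢.automorphicQuotient} [𝒢.IsAutomorphicMeasure μ] (ι : ↥U21 →* 𝒢.Adelic), Continuous ι →
      ∀ {W : Submodule ℂ (𝒢.Adelic → ℂ)},
      (∀ φ ∈ W, IsArchSmooth (H := u21Group) ι φ) →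
      (∀ X : u21Group.lie, ∀ φ ∈ W, lieDeriv (H := u21Group) ι X φ ∈ W) →
      ∀ (hrep : W ≤ 𝒢.l2Representable μ),
      (∀ (φ : 𝒢.Adelic → ℂ) (hφ : φ ∈ W), 𝒢.l2ClassOf μ ⟨φ, hrep hφ⟩ = 0 → φ = 0) →
      ∀ (V : Submodule ℂ (𝒢.Adelic → ℂ)) [FiniteDimensional ℂ V], V ≤ W →
      (∀ Y : u21Group.lie, (Y : Matrix (Fin 3) (Fin 3) ℂ) ∈ u21Group.compactLie →
        ∀ ψ ∈ V, lieDeriv (H := u21Group) ι Y ψ ∈ V) →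
      ∀ (c : ℂ), c * c = -1 →
      (∀ ψ ∈ V, ∀ b : Fin 2 → ℂ,
        lieDeriv (H := u21Group) ι (liePMat (Complex.I • b)) ψ = c • lieDeriv (H := u21Group) ι (liePMat b) ψ) →
      ∀ {φ : 𝒢.Adelic → ℂ},
      φ ∈ Submodule.span ℂ {χ | ∃ (l : List u21Group.lie) (ψ : 𝒢.Adelic → ℂ), ψ ∈ V ∧ χ = iterLieDeriv (H := u21Group) ι l ψ} →
      ∀ {f : 𝒢.automorphicQuotient → ℂ} (hf : MemLp f 2 μ), invQuot 𝒢 f = φ →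
      ∀ (X : u21Group.lie) (u : 𝒢.L2 μ) (t₀ : ℝ),
        AnalyticAt ℝ (fun t : ℝ => ⟪u, 𝒢.rightRegular μ (ι (u21Group.expMem (t • X))) (hf.toLp f)⟫_ℂ) t₀)
    (hE : ∀ S : Subgroup ↥U21, (∀ X : u21Group.lie, (u21Group.expMem X : ↥U21) ∈ S) → S = ⊤) :
    ∀ (L : Type) [Field L] [NumberField L] [IsCMField L] (ι : L →+* ℂ) (H : Matrix (Fin 3) (Fin 3) L) (T : GL (Fin 3) ℂ)
      (hT : (T : Matrix (Fin 3) (Fin 3) ℂ)ᴴ * H.map ι * (T : Matrix (Fin 3) (Fin 3) ℂ) = Literature.Geometry.ComplexHyperbolic.BallModel.J),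
      (∀ τ' : L →+* ℂ, InfinitePlace.mk τ' ≠ InfinitePlace.mk ι → (H.map τ').PosDef) →
      2 ≤ Module.finrank ℚ ↥(maximalRealSubfield L) →
      ∀ (μ : Measure (adelicGroupData (↥(maximalRealSubfield L)) L (IsCMField.complexConj L) 3 H).automorphicQuotient)
        [(adelicGroupData (↥(maximalRealSubfield L)) L (IsCMField.complexConj L) 3 H).IsAutomorphicMeasure μ]
        (Φ Φ₃ : (adelicGroupData (↥(maximalRealSubfield L)) L (IsCMField.complexConj L) 3 H).Adelic → (Fin 2 → ℂ)),
        Φ ∈ holCotForms (↥(maximalRealSubfield L)) L (IsCMField.complexConj L) 3 H (cmArchSection L ι H T hT) (cmCompactFactor L ι H T hT) →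
        Φ₃ ∈ holCotForms (↥(maximalRealSubfield L)) L (IsCMField.complexConj L) 3 H (cmArchSection L ι H T hT) (cmCompactFactor L ι H T hT) →
      ∀ (hΦ : ∀ j : Fin 2, MemLp (toQuotFun (adelicGroupData (↥(maximalRealSubfield L)) L (IsCMField.complexConj L) 3 H) fun x => Φ x j) 2 μ)
        (h₃ : ∀ j : Fin 2, MemLp (toQuotFun (adelicGroupData (↥(maximalRealSubfield L)) L (IsCMField.complexConj L) 3 H) fun x => Φ₃ x j) 2 μ),
      ∑ j : Fin 2, ⟪(hΦ j).toLp (toQuotFun (adelicGroupData (↥(maximalRealSubfield L)) L (IsCMField.complexConj L) 3 H) fun x => Φ x j),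
        (h₃ j).toLp (toQuotFun (adelicGroupData (↥(maximalRealSubfield L)) L (IsCMField.complexConj L) 3 H) fun x => Φ₃ x j)⟫_ℂ = 0 →
      ∀ (u : Literature.Geometry.ComplexHyperbolic.BallModel.U21) (j j' : Fin 2),
        ⟪(adelicGroupData (↥(maximalRealSubfield L)) L (IsCMField.complexConj L) 3 H).rightRegular μ (cmArchSection L ι H T hT u)
            ((hΦ j).toLp (toQuotFun (adelicGroupData (↥(maximalRealSubfield L)) L (IsCMField.complexConj L) 3 H) fun x => Φ x j)),
          (h₃ j').toLp (toQuotFun (adelicGroupData (↥(maximalRealSubfield L)) L (IsCMField.complexConj L) 3 H) fun x => Φ₃ x j')⟫_ℂ = 0 := by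
  intro L _ _ _ ι H T hT hdef h2 μ _ Φ Φ₃ hΦ hΦ₃ hm hm₃ htr u j j'
  -- the archimedean section and the compact quotient
  let ιA : ↥U21 →* (adelicGroupData (↥(maximalRealSubfield L)) L (IsCMField.complexConj L) 3 H).Adelic := cmArchSection L ι H T hT
  have hιA : Continuous ιA := continuous_archSectionU21CM L ι H T hT
  have h4 : 4 ≤ Module.finrank ℚ L := by
    have h := Module.finrank_mul_finrank ℚ ↥(maximalRealSubfield L) L
    rw [Algebra.IsQuadraticExtension.finrank_eq_two ↥(maximalRealSubfield L) L] at h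
    omega
  obtain ⟨τ, hτ⟩ := exists_infinitePlace_ne L h4 ι
  haveI : CompactSpace (adelicGroupData (↥(maximalRealSubfield L)) L (IsCMField.complexConj L) 3 H).automorphicQuotient :=
    compactSpace_cmDatum_automorphicQuotient_of_posDef L 3 H τ (hdef τ hτ)
  -- commutation of `ι_∞(U(2,1))` with `K_c` and with `U(H)(𝔸_f)`
  have hcommK : ∀ k ∈ cmCompactFactor L ι H T hT, ∀ u' : ↥U21, ιA u' * k = k * ιA u' := fun k hk u' =>
    cmArchSection_mul_of_mem_cmCompactFactor L ι H T hT u' hk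
  have hcommF : ∀ (g : finAdelic (↥(maximalRealSubfield L)) L (IsCMField.complexConj L) 3 H) (u' : ↥U21),
      ιA u' * finAdelicToAdelic (↥(maximalRealSubfield L)) L (IsCMField.complexConj L) 3 H g =
        finAdelicToAdelic (↥(maximalRealSubfield L)) L (IsCMField.complexConj L) 3 H g * ιA u' := fun g u' =>
    cmArchSection_mul_finAdelicToAdelic L ι H T hT u' g
  -- the space `W` of smooth, left-invariant, `K_c`- and `K_f`-invariant functions
  let W : Submodule ℂ ((adelicGroupData (↥(maximalRealSubfield L)) L (IsCMField.complexConj L) 3 H).Adelic → ℂ) :=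
    { carrier := {ψ | IsArchSmooth (H := u21Group) ιA ψ ∧
        (∀ γ ∈ (adelicGroupData (↥(maximalRealSubfield L)) L (IsCMField.complexConj L) 3 H).quotientSubgroup, ∀ g, ψ (γ * g) = ψ g) ∧
        (∀ k ∈ cmCompactFactor L ι H T hT, ∀ x, ψ (x * k) = ψ x) ∧
        ∃ Kf : Subgroup (finAdelic (↥(maximalRealSubfield L)) L (IsCMField.complexConj L) 3 H),
          IsOpen (Kf : Set (finAdelic (↥(maximalRealSubfield L)) L (IsCMField.complexConj L) 3 H)) ∧
          ∀ k ∈ Kf, ∀ x, ψ (x * finAdelicToAdelic (↥(maximalRealSubfield L)) L (IsCMField.complexConj L) 3 H k) = ψ x}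
      add_mem' := by
        rintro ψ ψ' ⟨h1, h2, h3, Kf, hKf, h4⟩ ⟨h1', h2', h3', Kf', hKf', h4'⟩
        refine ⟨IsArchSmooth.add (H := u21Group) ιA h1 h1', fun γ hγ g => ?_, fun k hk x => ?_, Kf ⊓ Kf', ?_, fun k hk x => ?_⟩
        · simp only [Pi.add_apply, h2 γ hγ g, h2' γ hγ g]
        · simp only [Pi.add_apply, h3 k hk x, h3' k hk x]
        · rw [Subgroup.coe_inf]; exact hKf.inter hKf'
        · simp only [Pi.add_apply, h4 k hk.1 x, h4' k hk.2 x]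
      zero_mem' := ⟨(archSmooth (H := u21Group) ιA).zero_mem, fun _ _ _ => rfl, fun _ _ _ => rfl, ⊤, isOpen_univ, fun _ _ _ => rfl⟩
      smul_mem' := by
        rintro a ψ ⟨h1, h2, h3, Kf, hKf, h4⟩
        refine ⟨IsArchSmooth.smul (H := u21Group) ιA a h1, fun γ hγ g => ?_, fun k hk x => ?_, Kf, hKf, fun k hk x => ?_⟩
        · simp only [Pi.smul_apply, h2 γ hγ g]
        · simp only [Pi.smul_apply, h3 k hk x]
        · simp only [Pi.smul_apply, h4 k hk x] }
  have hWmem : ∀ {ψ}, ψ ∈ W ↔ IsArchSmooth (H := u21Group) ιA ψ ∧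
        (∀ γ ∈ (adelicGroupData (↥(maximalRealSubfield L)) L (IsCMField.complexConj L) 3 H).quotientSubgroup, ∀ g, ψ (γ * g) = ψ g) ∧
        (∀ k ∈ cmCompactFactor L ι H T hT, ∀ x, ψ (x * k) = ψ x) ∧
        ∃ Kf : Subgroup (finAdelic (↥(maximalRealSubfield L)) L (IsCMField.complexConj L) 3 H),
          IsOpen (Kf : Set (finAdelic (↥(maximalRealSubfield L)) L (IsCMField.complexConj L) 3 H)) ∧
          ∀ k ∈ Kf, ∀ x, ψ (x * finAdelicToAdelic (↥(maximalRealSubfield L)) L (IsCMField.complexConj L) 3 H k) = ψ x :=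
    Iff.rfl
  have hsm : ∀ φ ∈ W, IsArchSmooth (H := u21Group) ιA φ := fun φ hφ => (hWmem.1 hφ).1
  have hleft : ∀ φ ∈ W, ∀ γ ∈ (adelicGroupData (↥(maximalRealSubfield L)) L (IsCMField.complexConj L) 3 H).quotientSubgroup,
      ∀ g, φ (γ * g) = φ g := fun φ hφ => (hWmem.1 hφ).2.1
  have hlie : ∀ X : u21Group.lie, ∀ φ ∈ W, lieDeriv (H := u21Group) ιA X φ ∈ W := by
    intro X φ hφ
    obtain ⟨h1, h2, h3, Kf, hKf, h4⟩ := hWmem.1 hφ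
    refine hWmem.2 ⟨isArchSmooth_lieDeriv_of_isArchSmooth (H := u21Group) ιA X h1, fun γ hγ g => ?_, fun k hk x => ?_, Kf, hKf,
      fun k hk x => ?_⟩
    · exact lieDeriv_apply_mul_left ιA X φ γ g (h2 γ hγ)
    · exact lieDeriv_apply_mul_right ιA X φ x k (fun u' => hcommK k hk u') (h3 k hk)
    · exact lieDeriv_apply_mul_right ιA X φ x _ (fun u' => hcommF k u') (h4 k hk)
  have hcont : ∀ φ ∈ W, Continuous φ := fun φ hφ =>
    hBii L ι H T hT hdef φ (continuous_slice_of_isArchSmooth ιA (hWmem.1 hφ).1) (hWmem.1 hφ).2.2.1 (hWmem.1 hφ).2.2.2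
  have hinvQ : ∀ φ ∈ W, invQuot _ (toQuotFun (adelicGroupData (↥(maximalRealSubfield L)) L (IsCMField.complexConj L) 3 H) φ) = φ :=
    fun φ hφ => funext fun g => by rw [invQuot_apply, ← apply_eq_toQuotFun (hleft φ hφ) g]
  have hmemLp : ∀ φ ∈ W, MemLp (toQuotFun (adelicGroupData (↥(maximalRealSubfield L)) L (IsCMField.complexConj L) 3 H) φ) 2 μ :=
    fun φ hφ => memLp_toQuotFun (hleft φ hφ) (hcont φ hφ) 2
  have hrep : W ≤ (adelicGroupData (↥(maximalRealSubfield L)) L (IsCMField.complexConj L) 3 H).l2Representable μ := fun φ hφ =>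
    ⟨_, hmemLp φ hφ, hinvQ φ hφ⟩
  have hinj : ∀ (φ : (adelicGroupData (↥(maximalRealSubfield L)) L (IsCMField.complexConj L) 3 H).Adelic → ℂ) (hφ : φ ∈ W),
      (adelicGroupData (↥(maximalRealSubfield L)) L (IsCMField.complexConj L) 3 H).l2ClassOf μ ⟨φ, hrep hφ⟩ = 0 → φ = 0 := by
    intro φ hφ h0
    rw [AdelicGroupData.l2ClassOf_eq (hmemLp φ hφ) (hinvQ φ hφ)] at h0
    by_contra hne
    exact toLp_toQuotFun_ne_zero (hleft φ hφ) (hcont φ hφ) (hmemLp φ hφ) hne h0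
  -- the holomorphic forms `Φ`, `Φ₃` have coordinates in `W`
  have hcoordW : ∀ {Ψ : (adelicGroupData (↥(maximalRealSubfield L)) L (IsCMField.complexConj L) 3 H).Adelic → (Fin 2 → ℂ)},
      Ψ ∈ holCotForms (↥(maximalRealSubfield L)) L (IsCMField.complexConj L) 3 H (cmArchSection L ι H T hT) (cmCompactFactor L ι H T hT) →
      ∀ i : Fin 2, (fun x => Ψ x i) ∈ W := by
    intro Ψ hΨ i
    have hΨ' := mem_holCotForms_iff.1 hΨ
    obtain ⟨Kf, hKf, hfix⟩ := exists_isOpen_forall_apply_mul_eq_of_mem_smoothFun hΨ'.2.2.1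
    refine hWmem.2 ⟨hBi L ι H T hT Ψ hΨ i, fun γ hγ g => ?_, fun k hk x => ?_, Kf, hKf, fun k hk x => ?_⟩
    · simp only [leftInvariant_of_mem_holCotForms hΨ γ hγ g]
    · simp only [hΨ'.2.1 k hk x]
    · simp only [hfix k hk x]
  have hKtype : ∀ {Ψ : (adelicGroupData (↥(maximalRealSubfield L)) L (IsCMField.complexConj L) 3 H).Adelic → (Fin 2 → ℂ)},
      Ψ ∈ holCotForms (↥(maximalRealSubfield L)) L (IsCMField.complexConj L) 3 H (cmArchSection L ι H T hT) (cmCompactFactor L ι H T hT) →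
      ∀ (k : stabilizer (↥U21) x₀) (g : (adelicGroupData (↥(maximalRealSubfield L)) L (IsCMField.complexConj L) 3 H).Adelic),
        Ψ (g * ιA k) = (isPullbackCocycle_cotangentCocycle.weightOf x₀) k⁻¹ (Ψ g) :=
    fun hΨ k g => (mem_holCotForms_iff.1 hΨ).1.2 k g
  -- L2A: all coordinate classes are orthogonal
  have horth := hA L ι H T hT μ Φ Φ₃ hΦ hΦ₃ hm hm₃ htr
  -- the core
  exact core ιA hιA W hsm hlie hrep hleft (hC _ ιA hιA μ W hsm hlie hrep)
    (fun V _ hVW hVK c hc hnull φ hφ f hf hfφ X v t₀ => hD ιA hιA hsm hlie hrep hinj V hVW hVK c hc hnull hφ hf hfφ X v t₀)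
    hE Φ Φ₃ (hcoordW hΦ) (hcoordW hΦ₃) (hKtype hΦ) (hKtype hΦ₃) (mem_holCotForms_iff.1 hΦ).2.2.2 hm hm₃ horth u j j'


/-- **S2⁺ PROVED — `stub_archOrth_hol_holds : ⟨ArchOrthHolType body, token for token (abbreviations `𝒰`, `hol` δ-unfolded)⟩`.**
All six cuts folded BY NAME: L2A ★ `F0P2aL2aKSchur.l2a_holds` (p04), L2B-i ★ `F0P2aL2bHolArchSmooth.sig_L2Bi_holds` and L2B-ii ★
`F0P2aL2bSliceContinuous.sig_L2Bii_holds` (p03), L2C ★ `F0P2aL2cOrderedProducts.sig_L2C_holds` (A-p08 engine + p08 consumer), L2D ★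
`F0P2aStubL2dNelson.stub_L2d_holds` (p02), L2E-i ★ `F0P2aL2eExpGeneration.subgroup_eq_top_of_forall_expMem_mem` (p01).  The edition fold is
`theorem stub_archOrth_hol : ArchOrthHolType := F0P2aArchOrthHol.stub_archOrth_hol_holds`.
[cite: HarishChandraTAMS1953, Cor. to Thm 2; Lemma 34] [cite: Nelson1959, §8] [cite: BorelWallach2000, VII 3.2] [cite: Liu2021, Lem. D.2 (2)] -/
theorem stub_archOrth_hol_holds :
    ∀ (L : Type) [Field L] [NumberField L] [IsCMField L] (ι : L →+* ℂ) (H : Matrix (Fin 3) (Fin 3) L) (T : GL (Fin 3) ℂ)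
      (hT : (T : Matrix (Fin 3) (Fin 3) ℂ)ᴴ * H.map ι * (T : Matrix (Fin 3) (Fin 3) ℂ) = Literature.Geometry.ComplexHyperbolic.BallModel.J),
      (∀ τ' : L →+* ℂ, InfinitePlace.mk τ' ≠ InfinitePlace.mk ι → (H.map τ').PosDef) →
      2 ≤ Module.finrank ℚ ↥(maximalRealSubfield L) →
      ∀ (μ : Measure (adelicGroupData (↥(maximalRealSubfield L)) L (IsCMField.complexConj L) 3 H).automorphicQuotient)
        [(adelicGroupData (↥(maximalRealSubfield L)) L (IsCMField.complexConj L) 3 H).IsAutomorphicMeasure μ]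
        (Φ Φ₃ : (adelicGroupData (↥(maximalRealSubfield L)) L (IsCMField.complexConj L) 3 H).Adelic → (Fin 2 → ℂ)),
        Φ ∈ holCotForms (↥(maximalRealSubfield L)) L (IsCMField.complexConj L) 3 H (cmArchSection L ι H T hT) (cmCompactFactor L ι H T hT) →
        Φ₃ ∈ holCotForms (↥(maximalRealSubfield L)) L (IsCMField.complexConj L) 3 H (cmArchSection L ι H T hT) (cmCompactFactor L ι H T hT) →
      ∀ (hΦ : ∀ j : Fin 2, MemLp (toQuotFun (adelicGroupData (↥(maximalRealSubfield L)) L (IsCMField.complexConj L) 3 H) fun x => Φ x j) 2 μ)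
        (h₃ : ∀ j : Fin 2, MemLp (toQuotFun (adelicGroupData (↥(maximalRealSubfield L)) L (IsCMField.complexConj L) 3 H) fun x => Φ₃ x j) 2 μ),
      ∑ j : Fin 2, ⟪(hΦ j).toLp (toQuotFun (adelicGroupData (↥(maximalRealSubfield L)) L (IsCMField.complexConj L) 3 H) fun x => Φ x j),
        (h₃ j).toLp (toQuotFun (adelicGroupData (↥(maximalRealSubfield L)) L (IsCMField.complexConj L) 3 H) fun x => Φ₃ x j)⟫_ℂ = 0 →
      ∀ (u : Literature.Geometry.ComplexHyperbolic.BallModel.U21) (j j' : Fin 2),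
        ⟪(adelicGroupData (↥(maximalRealSubfield L)) L (IsCMField.complexConj L) 3 H).rightRegular μ (cmArchSection L ι H T hT u)
            ((hΦ j).toLp (toQuotFun (adelicGroupData (↥(maximalRealSubfield L)) L (IsCMField.complexConj L) 3 H) fun x => Φ x j)),
          (h₃ j').toLp (toQuotFun (adelicGroupData (↥(maximalRealSubfield L)) L (IsCMField.complexConj L) 3 H) fun x => Φ₃ x j')⟫_ℂ = 0 :=
  archOrthHol_of_cuts F0P2aL2aKSchur.l2a_holds F0P2aL2bHolArchSmooth.sig_L2Bi_holds F0P2aL2bSliceContinuous.sig_L2Bii_holds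
    F0P2aL2cOrderedProducts.sig_L2C_holds F0P2aStubL2dNelson.stub_L2d_holds F0P2aL2eExpGeneration.subgroup_eq_top_of_forall_expMem_mem

end CM


end Summit.HodgeConjecture.HodgeConjecture.Cruxes.H413.F0P2aArchOrthHol

end
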